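import Summits.ResolutionOfSingularities.ResolutionOfSingularities.Theorems.EquisingularLiftEquisingularLiftNatTowerReachSsDefs
import Summits.ResolutionOfSingularities.ResolutionOfSingularities.Theorems.EquisingularLiftEquisingularLiftNatResidueHypDefs
import Summits.ResolutionOfSingularities.ResolutionOfSingularities.Theorems.EquisingularLiftEquisingularLiftNatCentreCodimTwoAdapters
import HarnessLib

/-!
# [OURS · L1 W4.5(b) · EL♮(3)] NOSE RESIDUE STRUCTURE, brick 1b — formal inclusions among the ten negated nose hypotheses of
# `stub_elnat_three_nonisolated_nonDefNoseTowerBTriplePrime`, the THREE-MEMBER CORE of the list, and the one-shot corollary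

Cell `res-hironaka`, rung L, slot W4.5(b), D-0157 DOOR 1 width seat `res-L1-w45b-nose-w4` (desk WIDTH TABLE D1, 2026-08-28T14:38:46Z, row nose-w4);
crux CHILD EL♮(3) = stmt-ResolutionOfSingularities-20148 (parent EL♮ stmt-…-20038), registered skeleton CHILD v40 (34th registration). OURS; NOT a
statement of any manuscript; nothing of [Hironaka2017] is asserted or used; AI kernel work, weaker than expert review. Resolution of singularities in
positive characteristic is NOT proved here (dimension 3 is a theorem in print, Cossart–Piltant 2008/2009; this is bookkeeping for OUR kernel-own route).
Pure logic over the tree's definitions (no `sorry`, no new definition, no instance, no notation; standard axioms).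
`--kind proof --supports stmt-ResolutionOfSingularities-20148 --as helper`.  Sister file (brick 1a, the ten unfoldings `not_X_iff`): `…NatNoseResidueUnfold`.

The registered nose residue carries, after the common binders, the ten negations
`¬ NoseHypCI → ¬ NoseHypDet → ¬ NoseHypLiftClass → ¬ NoseHypLiftClassTwo → ¬ ReachNoseTower₄ → ¬ ReachNoseTower₇ → ¬ ReachNoseTowerB →
¬ ReachNoseTowerBPrime → ¬ ReachNoseTowerBDoublePrime → ¬ ReachNoseTowerBTriplePrime` (all at `k n H ι`).  This file records:

* §2 FORMAL INCLUSIONS between the ten hypotheses (each `X → Y` over the tree's definitions, nothing restated):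
  `NoseHypCI → NoseHypLiftClass` and `NoseHypDet → NoseHypLiftClass` (the CI / determinantal data blocks of blobs #7/#8 are exactly the constructors
  `IsLiftableNoseClass.ci/.det` and the «then points» chains are token-identical), `NoseHypLiftClass → NoseHypLiftClassTwo` (`IsLiftableNoseClass₂.base`),
  `ReachNoseTower₄ → ReachNoseTower₇` (a nose `Z̃ ≅ ℙ¹_k` IS a curve: `ringKrullDim_stalk_eq_of_iso_projectiveSpace`; the ₃-rounds are among the ₅-rounds),
  hence with the tree's `reachNoseTowerB_of_reachNoseTower₇` / `reachNoseTowerBPrime_of_reachNoseTowerB` / `reachNoseTowerBDoublePrime_of_reachNoseTowerBPrime`: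
  `ReachNoseTower₄ → ReachNoseTower₇ → ReachNoseTowerB → ReachNoseTowerBPrime → ReachNoseTowerBDoublePrime`.
* §3 THE CORE — `nose_residue_hyps_iff_core`: the conjunction of the ten negations is EQUIVALENT to the conjunction of THREE of them,
  `¬ NoseHypLiftClassTwo ∧ ¬ ReachNoseTowerBDoublePrime ∧ ¬ ReachNoseTowerBTriplePrime`; the other seven are formally implied (idle in the registered
  statement — a fact for the planner's next re-cut, NOT a re-statement of the stub; the seven one-token derivations `not_X_of_not_Y` are provided).
  No formal inclusion `ReachNoseTowerBDoublePrime → ReachNoseTowerBTriplePrime` exists (the B‴ point-step E-menu `TowerPtRegB₄` drops the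
  `((γ ≫ υ') '' E).Finite` arm of the B/B′/B″ menu `TowerPtRegB`, cf. LEAD-MEMO-13 (L-a)), and the «then points» engine of `NoseHypLiftClassTwo` blows up
  NON-good points (`¬ IsRegularLocalRing` of the ambient allowed), which no tower engine does — so the three core negations are pairwise formally
  independent as typed.
* §4 ONE-SHOT COROLLARY — `not_isRegular_noseStrictTransform_of_not_noseHypLiftClassTwo`: under `¬ NoseHypLiftClassTwo`, for EVERY closed `Z ⊊ ι(H)` of the
  liftable nose class₂ and EVERY blow-up `υ` of `Z`, the reduced strict transform `closure (υ⁻¹(ι(H) ∖ Z))` of `H` is NOT regular — no class₂ nose (smooth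
  complete intersection, smooth determinantal locus, embedded `ℙ^r`, or a disjoint union of such) resolves `H` in one blow-up.

Companion memo (typed ≠ proved): `run/shared/lean/pub/res-hironaka/L/res-L1-w45b-nose-w4/NOSE-RESIDUE-CENSUS.md`.
-/

set_option linter.dupNamespace false

noncomputable section

open CategoryTheory CategoryTheory.Limits AlgebraicGeometry TopologicalSpace Topology IsLocalRing
open Literature.AlgebraicGeometry.Resolution
open AlgebraicGeometry.Scheme.IdealSheafData

namespace Summit.ResolutionOfSingularities.ResolutionOfSingularities.Cruxes.EquisingularLiftNat.Sections

/-! ## §2 Formal inclusions between the ten hypotheses -/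

/-- **CI noses are liftable-class noses**: the data block of `NoseHypCI` is exactly the constructor `IsLiftableNoseClass.ci` and the «then points» chains of
blobs #7 and #9 are token-identical. [OURS · L1 W4.5b · pure logic] -/
theorem noseHypLiftClass_of_noseHypCI (k : Type) [Field k] [IsAlgClosed k] (n : ℕ) (H : Scheme.{0})
    (ι : H ⟶ (Literature.AlgebraicGeometry.Motives.projectiveSpace n k).left) (h : NoseHypCI k n H ι) :
    NoseHypLiftClass k n H ι := by
  obtain ⟨c, f, d, hdeg, hne, hsub, hnsub, hjac, hSig, F₂, υ, hυ, F', ρ', T', hcl, hreg⟩ := h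
  exact ⟨_, hSig, IsLiftableNoseClass.ci c f d ⟨hdeg, hne, hjac, hSig⟩, hsub, hnsub, F₂, υ, hυ, F', ρ', T', hcl, hreg⟩

/-- **Determinantal noses are liftable-class noses**: the data block of `NoseHypDet` is the constructor `IsLiftableNoseClass.det` (the non-emptiness clause of
blob #8 is not even needed) and the chains are token-identical. [OURS · L1 W4.5b · pure logic] -/
theorem noseHypLiftClass_of_noseHypDet (k : Type) [Field k] [IsAlgClosed k] (n : ℕ) (H : Scheme.{0})
    (ι : H ⟶ (Literature.AlgebraicGeometry.Motives.projectiveSpace n k).left) (h : NoseHypDet k n H ι) :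
    NoseHypLiftClass k n H ι := by
  obtain ⟨t, M, α, β, hdeg, -, hsub, hnsub, hjac, hSig, F₂, υ, hυ, F', ρ', T', hcl, hreg⟩ := h
  exact ⟨_, hSig, IsLiftableNoseClass.det t M α β ⟨hdeg, hjac, hSig⟩, hsub, hnsub, F₂, υ, hυ, F', ρ', T', hcl, hreg⟩

/-- **Liftable-class noses are liftable-class₂ noses** (`IsLiftableNoseClass₂.base`; the chains of blobs #9 and #10 are token-identical).
[OURS · L1 W4.5b · pure logic] -/
theorem noseHypLiftClassTwo_of_noseHypLiftClass (k : Type) [Field k] [IsAlgClosed k] (n : ℕ) (H : Scheme.{0})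
    (ι : H ⟶ (Literature.AlgebraicGeometry.Motives.projectiveSpace n k).left) (h : NoseHypLiftClass k n H ι) :
    NoseHypLiftClassTwo k n H ι := by
  obtain ⟨Z, hZ, hcls, hsub, hnsub, F₂, υ, hυ, F', ρ', T', hcl, hreg⟩ := h
  exact ⟨Z, hZ, IsLiftableNoseClass₂.base Z hcls, hsub, hnsub, F₂, υ, hυ, F', ρ', T', hcl, hreg⟩

/-- **NOSE₄ ⊆ NOSE₇ — a rational nose IS a curve.** The clause `Nonempty (Z̃ ≅ ℙ¹_k)` of `ReachNoseTower₄` gives the curve clause of `ReachNoseTower₇`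
(`dim 𝒪_{Z̃,z} = 1` at closed points, by the tree's `ringKrullDim_stalk_eq_of_iso_projectiveSpace`), and closure under ₅-rounds implies closure under
₃-rounds (`towerRound₄_of_towerRound₅`, `towerRound₃_of_towerRound₄`). So `¬ ReachNoseTower₇ → ¬ ReachNoseTower₄`. [OURS · L1 W4.5b · pure logic + GW I 6.26] -/
theorem reachNoseTower₇_of_reachNoseTower₄ (k : Type) [Field k] (n : ℕ) (H : Scheme.{0})
    (ι : H ⟶ (Literature.AlgebraicGeometry.Motives.projectiveSpace n k).left) (h : ReachNoseTower₄ k n H ι) :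
    ReachNoseTower₇ k n H ι := by
  obtain ⟨Z, hZ, h1, h2, h3, h4, ⟨e⟩, F₂, υ, hυ, F', γ', T', E', K', hcl, hreg⟩ := h
  exact ⟨Z, hZ, h1, h2, h3, h4, fun z hz => ringKrullDim_stalk_eq_of_iso_projectiveSpace 1 e z hz, F₂, υ, hυ, F', γ', T', E', K',
    fun R₁ hseed hreg' hram hround => hcl R₁ hseed hreg' hram
      (towerRound₃_of_towerRound₄ _ F₂ υ Z hZ R₁ (towerRound₄_of_towerRound₅ _ F₂ υ Z hZ R₁ hround)), hreg⟩

/-- **NOSE₄ ⊆ NOSE-B″** (composite of `reachNoseTower₇_of_reachNoseTower₄` with the tree's forgetful maps ₇ ⊆ B ⊆ B′ ⊆ B″). [OURS · L1 W4.5b · pure logic] -/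
theorem reachNoseTowerBDoublePrime_of_reachNoseTower₄ (k : Type) [Field k] (n : ℕ) (H : Scheme.{0})
    (ι : H ⟶ (Literature.AlgebraicGeometry.Motives.projectiveSpace n k).left) (h : ReachNoseTower₄ k n H ι) :
    ReachNoseTowerBDoublePrime k n H ι :=
  reachNoseTowerBDoublePrime_of_reachNoseTowerBPrime k n H ι (reachNoseTowerBPrime_of_reachNoseTowerB k n H ι
    (reachNoseTowerB_of_reachNoseTower₇ k n H ι (reachNoseTower₇_of_reachNoseTower₄ k n H ι h)))

/-! ## §3 The core of the residue's hypothesis list: seven of the ten negations are formally idle -/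

/-- `¬ NoseHypLiftClassTwo → ¬ NoseHypCI` (residue hypothesis #7 is idle given #10). [OURS · pure logic] -/
theorem not_noseHypCI_of_not_noseHypLiftClassTwo (k : Type) [Field k] [IsAlgClosed k] (n : ℕ) (H : Scheme.{0})
    (ι : H ⟶ (Literature.AlgebraicGeometry.Motives.projectiveSpace n k).left) (h : ¬ NoseHypLiftClassTwo k n H ι) :
    ¬ NoseHypCI k n H ι :=
  fun h' => h (noseHypLiftClassTwo_of_noseHypLiftClass k n H ι (noseHypLiftClass_of_noseHypCI k n H ι h'))

/-- `¬ NoseHypLiftClassTwo → ¬ NoseHypDet` (residue hypothesis #8 is idle given #10). [OURS · pure logic] -/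
theorem not_noseHypDet_of_not_noseHypLiftClassTwo (k : Type) [Field k] [IsAlgClosed k] (n : ℕ) (H : Scheme.{0})
    (ι : H ⟶ (Literature.AlgebraicGeometry.Motives.projectiveSpace n k).left) (h : ¬ NoseHypLiftClassTwo k n H ι) :
    ¬ NoseHypDet k n H ι :=
  fun h' => h (noseHypLiftClassTwo_of_noseHypLiftClass k n H ι (noseHypLiftClass_of_noseHypDet k n H ι h'))

/-- `¬ NoseHypLiftClassTwo → ¬ NoseHypLiftClass` (residue hypothesis #9 is idle given #10). [OURS · pure logic] -/
theorem not_noseHypLiftClass_of_not_noseHypLiftClassTwo (k : Type) [Field k] [IsAlgClosed k] (n : ℕ) (H : Scheme.{0})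
    (ι : H ⟶ (Literature.AlgebraicGeometry.Motives.projectiveSpace n k).left) (h : ¬ NoseHypLiftClassTwo k n H ι) :
    ¬ NoseHypLiftClass k n H ι :=
  fun h' => h (noseHypLiftClassTwo_of_noseHypLiftClass k n H ι h')

/-- `¬ ReachNoseTowerBDoublePrime → ¬ ReachNoseTowerBPrime` (idle given `¬B″`). [OURS · pure logic] -/
theorem not_reachNoseTowerBPrime_of_not_reachNoseTowerBDoublePrime (k : Type) [Field k] (n : ℕ) (H : Scheme.{0})
    (ι : H ⟶ (Literature.AlgebraicGeometry.Motives.projectiveSpace n k).left) (h : ¬ ReachNoseTowerBDoublePrime k n H ι) :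
    ¬ ReachNoseTowerBPrime k n H ι :=
  fun h' => h (reachNoseTowerBDoublePrime_of_reachNoseTowerBPrime k n H ι h')

/-- `¬ ReachNoseTowerBDoublePrime → ¬ ReachNoseTowerB` (idle given `¬B″`). [OURS · pure logic] -/
theorem not_reachNoseTowerB_of_not_reachNoseTowerBDoublePrime (k : Type) [Field k] (n : ℕ) (H : Scheme.{0})
    (ι : H ⟶ (Literature.AlgebraicGeometry.Motives.projectiveSpace n k).left) (h : ¬ ReachNoseTowerBDoublePrime k n H ι) :
    ¬ ReachNoseTowerB k n H ι :=
  fun h' => h (reachNoseTowerBDoublePrime_of_reachNoseTowerBPrime k n H ι (reachNoseTowerBPrime_of_reachNoseTowerB k n H ι h'))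

/-- `¬ ReachNoseTowerBDoublePrime → ¬ ReachNoseTower₇` (idle given `¬B″`). [OURS · pure logic] -/
theorem not_reachNoseTower₇_of_not_reachNoseTowerBDoublePrime (k : Type) [Field k] (n : ℕ) (H : Scheme.{0})
    (ι : H ⟶ (Literature.AlgebraicGeometry.Motives.projectiveSpace n k).left) (h : ¬ ReachNoseTowerBDoublePrime k n H ι) :
    ¬ ReachNoseTower₇ k n H ι :=
  fun h' => not_reachNoseTowerB_of_not_reachNoseTowerBDoublePrime k n H ι h (reachNoseTowerB_of_reachNoseTower₇ k n H ι h')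

/-- `¬ ReachNoseTowerBDoublePrime → ¬ ReachNoseTower₄` (idle given `¬B″`, through `reachNoseTower₇_of_reachNoseTower₄`). [OURS · pure logic] -/
theorem not_reachNoseTower₄_of_not_reachNoseTowerBDoublePrime (k : Type) [Field k] (n : ℕ) (H : Scheme.{0})
    (ι : H ⟶ (Literature.AlgebraicGeometry.Motives.projectiveSpace n k).left) (h : ¬ ReachNoseTowerBDoublePrime k n H ι) :
    ¬ ReachNoseTower₄ k n H ι :=
  fun h' => h (reachNoseTowerBDoublePrime_of_reachNoseTower₄ k n H ι h')

/-- **THE CORE OF THE NOSE RESIDUE'S HYPOTHESES.** The conjunction of the ten negated nose hypotheses of the registered residue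
`stub_elnat_three_nonisolated_nonDefNoseTowerBTriplePrime` (at fixed `k n H ι`) is EQUIVALENT to the conjunction of three of them:
`¬ NoseHypLiftClassTwo ∧ ¬ ReachNoseTowerBDoublePrime ∧ ¬ ReachNoseTowerBTriplePrime`.  (For the planner: the other seven can be DERIVED in the next texts;
this lemma restates no stub.) [OURS · L1 W4.5b · pure logic] -/
theorem nose_residue_hyps_iff_core (k : Type) [Field k] [IsAlgClosed k] (n : ℕ) (H : Scheme.{0})
    (ι : H ⟶ (Literature.AlgebraicGeometry.Motives.projectiveSpace n k).left) :
    (¬ NoseHypCI k n H ι ∧ ¬ NoseHypDet k n H ι ∧ ¬ NoseHypLiftClass k n H ι ∧ ¬ NoseHypLiftClassTwo k n H ι ∧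
      ¬ ReachNoseTower₄ k n H ι ∧ ¬ ReachNoseTower₇ k n H ι ∧ ¬ ReachNoseTowerB k n H ι ∧ ¬ ReachNoseTowerBPrime k n H ι ∧
      ¬ ReachNoseTowerBDoublePrime k n H ι ∧ ¬ ReachNoseTowerBTriplePrime k n H ι) ↔
    (¬ NoseHypLiftClassTwo k n H ι ∧ ¬ ReachNoseTowerBDoublePrime k n H ι ∧ ¬ ReachNoseTowerBTriplePrime k n H ι) := by
  constructor
  · rintro ⟨-, -, -, hlc2, -, -, -, -, hBPP, hBT⟩
    exact ⟨hlc2, hBPP, hBT⟩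
  · rintro ⟨hlc2, hBPP, hBT⟩
    exact ⟨not_noseHypCI_of_not_noseHypLiftClassTwo k n H ι hlc2, not_noseHypDet_of_not_noseHypLiftClassTwo k n H ι hlc2,
      not_noseHypLiftClass_of_not_noseHypLiftClassTwo k n H ι hlc2, hlc2,
      not_reachNoseTower₄_of_not_reachNoseTowerBDoublePrime k n H ι hBPP, not_reachNoseTower₇_of_not_reachNoseTowerBDoublePrime k n H ι hBPP,
      not_reachNoseTowerB_of_not_reachNoseTowerBDoublePrime k n H ι hBPP, not_reachNoseTowerBPrime_of_not_reachNoseTowerBDoublePrime k n H ι hBPP,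
      hBPP, hBT⟩

/-! ## §4 One-shot corollary: no class₂ nose resolves `H` in one blow-up -/

/-- **No liftable-class₂ nose resolves `H` in one step.** Under `¬ NoseHypLiftClassTwo k n H ι`: for every closed `Z ⊊ ι(H)` of the liftable nose class₂
(`Z ⊆ ι(H)`) and every blow-up `υ : F₂ → ℙⁿ_k` of `Z`, the reduced strict transform `closure (υ⁻¹(ι(H) ∖ Z))` of `H` is NOT regular (the empty «then
points» chain is a chain). [OURS · L1 W4.5b · pure logic] -/
theorem not_isRegular_noseStrictTransform_of_not_noseHypLiftClassTwo (k : Type) [Field k] [IsAlgClosed k] (n : ℕ) (H : Scheme.{0})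
    (ι : H ⟶ (Literature.AlgebraicGeometry.Motives.projectiveSpace n k).left) (h : ¬ NoseHypLiftClassTwo k n H ι)
    (Z : Set (Literature.AlgebraicGeometry.Motives.projectiveSpace n k).left) (hZ : IsClosed Z) (hcls : IsLiftableNoseClass₂ k n Z)
    (hsub : Z ⊆ Set.range ι) (hnsub : ¬ (Set.range ι ⊆ Z))
    (F₂ : Scheme.{0}) (υ : F₂ ⟶ (Literature.AlgebraicGeometry.Motives.projectiveSpace n k).left)
    (hυ : IsBlowup υ (Scheme.IdealSheafData.vanishingIdeal
      (⟨Z, hZ⟩ : Closeds (Literature.AlgebraicGeometry.Motives.projectiveSpace n k).left))) :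
    ¬ Literature.AlgebraicGeometry.Resolution.Scheme.IsRegular
      (vanishingIdeal (⟨closure (υ ⁻¹' (Set.range ι \ Z)), isClosed_closure⟩ : Closeds F₂)).subscheme := by
  intro hreg
  have hc : (⟨closure (closure (υ ⁻¹' (Set.range ι \ Z))), isClosed_closure⟩ : Closeds F₂) =
      ⟨closure (υ ⁻¹' (Set.range ι \ Z)), isClosed_closure⟩ :=
    Closeds.ext closure_closure
  exact h ⟨Z, hZ, hcls, hsub, hnsub, F₂, υ, hυ, F₂, 𝟙 F₂, closure (υ ⁻¹' (Set.range ι \ Z)), fun Q hQ _ => hQ, by rw [hc]; exact hreg⟩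


end Summit.ResolutionOfSingularities.ResolutionOfSingularities.Cruxes.EquisingularLiftNat.Sections

end
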